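import Summits.Ventures.HSemireg.WedgeHankelRecurrenceDistinctRoots

/-!
# Venture HSemireg — THE SEPARABLE PART `m / gcd(m, m′)` IN EVERY CHARACTERISTIC: for `m` monic of degree `t + 1` over ANY field **`rank (dualSeq m m′ (i + j))_{i,j ≤ t} = deg (m / gcd(m, m′))`**
# (N96 rewritten: the rank of the Hankel matrix of the Newton sums IS the degree of the quotient `m / gcd(m, m′)` — no splitting field, no characteristic hypothesis), and that quotient is
# **ALWAYS SEPARABLE**: when `m` splits its roots are exactly the distinct roots `λ` of `m` whose multiplicity `e_λ` is non-zero in the field, each ONCE (`roots (m / gcd(m, m′)) = {λ : e_λ ≠ 0 in K}`),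
# hence `m / gcd(m, m′)` splits with simple roots; for arbitrary `m ≠ 0` separability descends from the splitting field (`gcd`, `′` and exact division commute with field embeddings).  In
# characteristic `0` it is the radical ∕ squarefree part (von zur Gathen–Gerhard Thm. 14.20, Cox–Little–O'Shea Ch. 1 §5 Ex. 15(a), both PROVED Literature); in characteristic `p` it is the
# product of the SEPARABLE irreducible factors occurring with multiplicity prime to `p`, and `m / gcd(m, m′) = 1 ⟺ m′ = 0`.

HONEST FRAMING. Part of the Lean index of the computation cell `pub-hsemireg` (seat p10 gen 32, Sunday typer «UNIFORM-IN-n»).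
LINEAR ALGEBRA OF HANKEL (catalecticant) MATRICES and of polynomials over a field ONLY (`EuclideanDomain.gcd`, Euclidean division on `K[X]`, `Polynomial.roots`, `Polynomial.Separable`): no variety,
no cohomology theory, no sheaf, no Ext group and no semiregularity map is constructed here; nothing here says that HC / HC_CM / HC_AV holds; no Literature FACT is declared or used (the PROVED
Literature `PrincipalIdealRadicalFormula` arrives through N110's imports and is used once more in §677).  Custodian versions as in `WedgeHankelSiegelIdeal` (1/3).

WHAT IS IN THE TREE.  N96 (`WedgeHankelRecurrenceSeparable`): `rank_hankelSq_dualSeq_derivative` (`rank H_t(m′/m) = t + 1 − deg gcd(m, m′)`).  N110 (`WedgeHankelRecurrenceDistinctRoots`): `count_roots_gcd_derivative`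
(multiplicity of `λ` in `gcd(m, m′)` = `e_λ − [e_λ ≠ 0 in K]`), `natDegree_gcd_derivative_add_card_filter`, `associated_euclidGcd_gcd`.  PROVED Literature: `RingTheory/MvPolynomial/PrincipalIdealRadicalFormula`
(`associated_div_gcd_derivative_radical`: characteristic `0`, `f / gcd f f′ ~ rad f` for Mathlib's normalised `gcd`), `Algebra/Polynomial/YunSquarefree` (von zur Gathen–Gerhard §14.6: in characteristic `0`,
`f / gcd(f, f′)` is the squarefree part, `div_gcd_derivative_eq_of_sqfreeDecomp`; Yun's algorithm) — characteristic `0` only; `Algebra/Polynomial/BerlekampSubalgebra` (`gcd u u′ = 1 ⇒ Squarefree u`).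
Mathlib: `EuclideanDomain.mul_div_cancel'`, `Polynomial.map_div`, `gcd_map`, `derivative_map`, `roots_mul`, `nodup_roots_iff_of_splits`, `separable_map`, `Splits.of_dvd`; Mathlib has no statement about
`p / gcd(p, p′)`.  `rg` over lean∕Summits + Literature: no separability ∕ root statement for `m / gcd(m, m′)` outside characteristic `0`.
THIS FILE (namespace `Summit.Ventures.HSemireg.Wedge.HankelOuter` continued; CHAINED on N110; 0 definitions):
* §674 `gcd_mul_div_gcd_derivative` (`gcd · (m / gcd) = m`), `div_gcd_derivative_ne_zero`, `natDegree_div_gcd_derivative_add` (`deg (m / gcd) + deg gcd = deg m`),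
  **`rank_hankelSq_dualSeq_derivative_eq_natDegree_div_gcd`** (`rank H_t(m′/m) = deg (m / gcd(m, m′))`, ANY field), `div_gcd_derivative_eq_one_iff` (`= 1 ⟺ m′ = 0`, `m ≠ 0`),
  `rank_hankelSq_dualSeq_derivative_eq_zero_iff` (`rank H_t(m′/m) = 0 ⟺ m′ = 0`).
* §675 split `m`: **`count_roots_div_gcd_derivative`** (multiplicity of `λ` in `m / gcd` = `[e_λ ≠ 0 in K]`), **`roots_div_gcd_derivative`** (`= (roots m).toFinset.filter (e ≠ 0 in K)` as a multiset),
  `splits_div_gcd_derivative`, `nodup_roots_div_gcd_derivative`, `separable_div_gcd_derivative_of_splits`, `roots_div_gcd_derivative_of_charZero` (`= dedup (roots m)`).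
* §676 any `m ≠ 0`: `map_div_gcd_derivative` (commutes with field embeddings), **`separable_div_gcd_derivative`** (ALWAYS SEPARABLE), `squarefree_div_gcd_derivative`, `isCoprime_div_gcd_derivative`.
* §677 characteristic `0`: `associated_div_euclidGcd_derivative_radical` (`m / gcd(m, m′) ~ rad m` with `EuclideanDomain.gcd`, via the Literature theorem), `natDegree_div_gcd_derivative_eq_natDegree_radical`.
Nothing Ext-side.  New names only.
-/

open Module Polynomial
open scoped Matrix Polynomial

namespace Summit.Ventures.HSemireg.Wedge.HankelOuter

open Summit.Ventures.HSemireg.Wedge Summit.Ventures.HSemireg.Wedge.Hankel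

variable (K : Type*) [Field K]

/-! ## §674. `m / gcd(m, m′)`: degree, and the rank of `H_t(m′/m)` over any field -/

/-- `gcd(m, m′) · (m / gcd(m, m′)) = m` (exact Euclidean division in `K[X]`). -/
theorem gcd_mul_div_gcd_derivative [DecidableEq K] (m : K[X]) :
    EuclideanDomain.gcd m (derivative m) * (m / EuclideanDomain.gcd m (derivative m)) = m := by
  rcases eq_or_ne m 0 with rfl | hm
  · rw [derivative_zero, EuclideanDomain.gcd_zero_left, EuclideanDomain.zero_div, mul_zero]
  · exact EuclideanDomain.mul_div_cancel' (fun h => hm (EuclideanDomain.gcd_eq_zero_iff.mp h).1) (EuclideanDomain.gcd_dvd_left m (derivative m))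

/-- `m / gcd(m, m′) ≠ 0` for `m ≠ 0`. -/
theorem div_gcd_derivative_ne_zero [DecidableEq K] {m : K[X]} (hm : m ≠ 0) : m / EuclideanDomain.gcd m (derivative m) ≠ 0 := fun h => by
  have h2 := gcd_mul_div_gcd_derivative K m
  rw [h, mul_zero] at h2
  exact hm h2.symm

/-- `deg (m / gcd(m, m′)) + deg gcd(m, m′) = deg m` (`m ≠ 0`). -/
theorem natDegree_div_gcd_derivative_add [DecidableEq K] {m : K[X]} (hm : m ≠ 0) :
    (m / EuclideanDomain.gcd m (derivative m)).natDegree + (EuclideanDomain.gcd m (derivative m)).natDegree = m.natDegree := by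
  have hg : EuclideanDomain.gcd m (derivative m) ≠ 0 := fun h => hm (EuclideanDomain.gcd_eq_zero_iff.mp h).1
  conv_rhs => rw [← gcd_mul_div_gcd_derivative K m]
  rw [Polynomial.natDegree_mul hg (div_gcd_derivative_ne_zero K hm), add_comm]

/-- **HERMITE'S ROOT COUNT, INTRINSIC FORM OVER ANY FIELD: `rank (dualSeq m m′ (i + j))_{i,j ≤ t} = deg (m / gcd(m, m′))`** (`m` monic of degree `t + 1`; N96's `t + 1 − deg gcd(m, m′)` rewritten) —
the rank of the Hankel matrix of the Newton sums is the degree of the separable part (§676), with no splitting field and no hypothesis on the characteristic. -/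
theorem rank_hankelSq_dualSeq_derivative_eq_natDegree_div_gcd [DecidableEq K] {t : ℕ} {m : K[X]} (hm : m.Monic) (hmd : m.natDegree = t + 1) :
    (hankelSq K t (dualSeq K m (derivative m))).rank = (m / EuclideanDomain.gcd m (derivative m)).natDegree := by
  rw [rank_hankelSq_dualSeq_derivative K hm hmd]
  have h := natDegree_div_gcd_derivative_add K hm.ne_zero
  omega

/-- **`m / gcd(m, m′) = 1 ⟺ m′ = 0`** (`m ≠ 0`): the separable part is trivial exactly for the polynomials in `X^p` (characteristic `p`) ∕ the non-zero constants. -/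
theorem div_gcd_derivative_eq_one_iff [DecidableEq K] {m : K[X]} (hm : m ≠ 0) : m / EuclideanDomain.gcd m (derivative m) = 1 ↔ derivative m = 0 := by
  refine ⟨fun h => ?_, fun h => ?_⟩
  · have h2 := gcd_mul_div_gcd_derivative K m
    rw [h, mul_one] at h2
    -- `gcd = m` divides `m′`, whose degree is smaller
    have hdvd : m ∣ derivative m := by
      have h3 := EuclideanDomain.gcd_dvd_right m (derivative m)
      rwa [h2] at h3
    by_contra hne
    have hm0 : m.natDegree ≠ 0 := fun h0 => hne (by rw [Polynomial.eq_C_of_natDegree_eq_zero h0, derivative_C])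
    have h3 := Polynomial.natDegree_le_of_dvd hdvd hne
    have h4 := Polynomial.natDegree_derivative_lt hm0
    omega
  · rw [h, EuclideanDomain.gcd_zero_right, EuclideanDomain.div_self hm]

/-- **`rank H_t(m′/m) = 0 ⟺ m′ = 0`** (`m` monic of degree `t + 1`): the Hankel matrix of the Newton sums vanishes in rank exactly when `m` is a polynomial in `X^p`. -/
theorem rank_hankelSq_dualSeq_derivative_eq_zero_iff [DecidableEq K] {t : ℕ} {m : K[X]} (hm : m.Monic) (hmd : m.natDegree = t + 1) :
    (hankelSq K t (dualSeq K m (derivative m))).rank = 0 ↔ derivative m = 0 := by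
  rw [rank_hankelSq_dualSeq_derivative_eq_natDegree_div_gcd K hm hmd, ← div_gcd_derivative_eq_one_iff K hm.ne_zero]
  refine ⟨fun h => ?_, fun h => by rw [h, Polynomial.natDegree_one]⟩
  -- degree `0` and `gcd · q = m` monic up to the unit: `q` is a unit `c`, and `gcd(m, m′) · c = m`; compare with `gcd ∣ m′`... simpler: `q ∣ m` has degree 0 and `m / gcd` with `gcd ∣ m`:
  -- from `deg q = 0`, `q = C c` with `c ≠ 0`; then `gcd = m · C c⁻¹` divides `m′`, forcing `m′ = 0`, whence `gcd = m` and `q = 1`.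
  have hq0 := div_gcd_derivative_ne_zero K hm.ne_zero
  obtain ⟨c, hc⟩ := Polynomial.natDegree_eq_zero.mp h
  have hc0 : c ≠ 0 := fun h0 => hq0 (by rw [← hc, h0, map_zero])
  have h2 := gcd_mul_div_gcd_derivative K m
  rw [← hc] at h2
  have hdvd : m ∣ derivative m := by
    have h3 : EuclideanDomain.gcd m (derivative m) = m * C c⁻¹ := by
      calc EuclideanDomain.gcd m (derivative m) = EuclideanDomain.gcd m (derivative m) * (C c * C c⁻¹) := by
            rw [← Polynomial.C_mul, mul_inv_cancel₀ hc0, Polynomial.C_1, mul_one]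
        _ = m * C c⁻¹ := by rw [← mul_assoc, h2]
    have h4 := EuclideanDomain.gcd_dvd_right m (derivative m)
    rw [h3] at h4
    exact (dvd_mul_right m (C c⁻¹)).trans h4
  have hd : derivative m = 0 := by
    by_contra hne
    have hm0 : m.natDegree ≠ 0 := fun h0 => hne (by rw [Polynomial.eq_C_of_natDegree_eq_zero h0, derivative_C])
    have h3 := Polynomial.natDegree_le_of_dvd hdvd hne
    have h4 := Polynomial.natDegree_derivative_lt hm0
    omega
  exact (div_gcd_derivative_eq_one_iff K hm.ne_zero).mpr hd

/-! ## §675. Split `m`: the roots of `m / gcd(m, m′)` -/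

/-- **The multiplicity of `λ` in `m / gcd(m, m′)` is `[e_λ ≠ 0 in K]`** (`m ≠ 0`, `e_λ` = multiplicity of `λ` in `m`; every characteristic): `roots m = roots gcd + roots (m / gcd)` and N110's count for
the `gcd`. -/
theorem count_roots_div_gcd_derivative [DecidableEq K] {m : K[X]} (hm : m ≠ 0) (a : K) :
    (m / EuclideanDomain.gcd m (derivative m)).roots.count a = if ((m.roots.count a : ℕ) : K) = 0 then 0 else 1 := by
  have hprod : (EuclideanDomain.gcd m (derivative m) * (m / EuclideanDomain.gcd m (derivative m))).roots.count a = m.roots.count a := by rw [gcd_mul_div_gcd_derivative K m]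
  rw [Polynomial.roots_mul (by rw [gcd_mul_div_gcd_derivative K m]; exact hm), Multiset.count_add, count_roots_gcd_derivative K hm a] at hprod
  have h1 : (if ((m.roots.count a : ℕ) : K) = 0 then 0 else 1) ≤ m.roots.count a := by
    split_ifs with h
    · exact Nat.zero_le _
    · exact Nat.one_le_iff_ne_zero.mpr fun h0 => h (by rw [h0, Nat.cast_zero])
  omega

/-- **`roots (m / gcd(m, m′)) = {λ ∈ roots m : e_λ ≠ 0 in K}`** (as a multiset: each such `λ` exactly once; `m ≠ 0`; every characteristic). -/
theorem roots_div_gcd_derivative [DecidableEq K] {m : K[X]} (hm : m ≠ 0) :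
    (m / EuclideanDomain.gcd m (derivative m)).roots = (m.roots.toFinset.filter fun a => ((m.roots.count a : ℕ) : K) ≠ 0).val := by
  refine Multiset.ext.mpr fun a => ?_
  rw [count_roots_div_gcd_derivative K hm a, Multiset.count_eq_of_nodup (Finset.nodup _)]
  simp only [Finset.mem_val, Finset.mem_filter, Multiset.mem_toFinset, ne_eq]
  by_cases h : ((m.roots.count a : ℕ) : K) = 0
  · rw [if_pos h, if_neg (fun h' => h'.2 h)]
  · rw [if_neg h, if_pos ⟨Multiset.count_ne_zero.mp (fun h0 => h (by rw [h0, Nat.cast_zero])), h⟩]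

/-- `m / gcd(m, m′)` splits whenever `m ≠ 0` does (it divides `m`). -/
theorem splits_div_gcd_derivative [DecidableEq K] {m : K[X]} (hm : m ≠ 0) (hs : m.Splits) : (m / EuclideanDomain.gcd m (derivative m)).Splits :=
  hs.of_dvd hm (EuclideanDomain.div_dvd_of_dvd (EuclideanDomain.gcd_dvd_left m (derivative m)))

/-- The roots of `m / gcd(m, m′)` are simple (`m ≠ 0`). -/
theorem nodup_roots_div_gcd_derivative [DecidableEq K] {m : K[X]} (hm : m ≠ 0) : (m / EuclideanDomain.gcd m (derivative m)).roots.Nodup := by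
  rw [roots_div_gcd_derivative K hm]
  exact Finset.nodup _

/-- Split `m ≠ 0`: `m / gcd(m, m′)` is separable (it splits with simple roots). -/
theorem separable_div_gcd_derivative_of_splits [DecidableEq K] {m : K[X]} (hm : m ≠ 0) (hs : m.Splits) : (m / EuclideanDomain.gcd m (derivative m)).Separable :=
  (Polynomial.nodup_roots_iff_of_splits (div_gcd_derivative_ne_zero K hm) (splits_div_gcd_derivative K hm hs)).mp (nodup_roots_div_gcd_derivative K hm)

/-- Characteristic `0`, split `m ≠ 0`: **`roots (m / gcd(m, m′)) = dedup (roots m)`** — every root of `m` exactly once (the squarefree part). -/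
theorem roots_div_gcd_derivative_of_charZero [DecidableEq K] [CharZero K] {m : K[X]} (hm : m ≠ 0) :
    (m / EuclideanDomain.gcd m (derivative m)).roots = m.roots.dedup := by
  rw [roots_div_gcd_derivative K hm, Finset.filter_true_of_mem fun a ha => Nat.cast_ne_zero.mpr (Multiset.count_ne_zero.mpr (Multiset.mem_toFinset.mp ha)), Multiset.toFinset_val]

/-! ## §676. Any `m ≠ 0`: `m / gcd(m, m′)` is separable -/

/-- `m / gcd(m, m′)` commutes with field embeddings: `(m / gcd(m, m′)).map φ = (φ m) / gcd(φ m, (φ m)′)`. -/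
theorem map_div_gcd_derivative [DecidableEq K] {L : Type*} [Field L] [DecidableEq L] (φ : K →+* L) (m : K[X]) :
    (m / EuclideanDomain.gcd m (derivative m)).map φ = m.map φ / EuclideanDomain.gcd (m.map φ) (derivative (m.map φ)) := by
  rw [Polynomial.map_div, Polynomial.derivative_map, Polynomial.gcd_map]

/-- **`m / gcd(m, m′)` IS SEPARABLE for every `m ≠ 0` over every field** — in the splitting field of `m` it splits with simple roots (§675), and separability descends along the embedding. (In
characteristic `0` this is the squarefree part ∕ radical; in characteristic `p` it is the product of the separable irreducible factors of `m` occurring with multiplicity prime to `p`.) -/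
theorem separable_div_gcd_derivative [DecidableEq K] {m : K[X]} (hm : m ≠ 0) : (m / EuclideanDomain.gcd m (derivative m)).Separable := by
  classical
  rw [← Polynomial.separable_map (algebraMap K m.SplittingField), map_div_gcd_derivative K (algebraMap K m.SplittingField) m]
  exact separable_div_gcd_derivative_of_splits m.SplittingField (Polynomial.map_ne_zero hm) (SplittingField.splits m)

/-- `m / gcd(m, m′)` is squarefree (`m ≠ 0`, any field). -/
theorem squarefree_div_gcd_derivative [DecidableEq K] {m : K[X]} (hm : m ≠ 0) : Squarefree (m / EuclideanDomain.gcd m (derivative m)) :=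
  (separable_div_gcd_derivative K hm).squarefree

/-- `m / gcd(m, m′)` is coprime to its own derivative (`m ≠ 0`; Mathlib's definition of `Separable`). -/
theorem isCoprime_div_gcd_derivative [DecidableEq K] {m : K[X]} (hm : m ≠ 0) :
    IsCoprime (m / EuclideanDomain.gcd m (derivative m)) (derivative (m / EuclideanDomain.gcd m (derivative m))) :=
  (Polynomial.separable_def _).mp (separable_div_gcd_derivative K hm)

/-! ## §677. Characteristic `0`: the separable part is the radical -/

/-- Characteristic `0`: **`m / gcd(m, m′) ~ rad m`** with `EuclideanDomain.gcd` and Euclidean division (the PROVED Literature Cox–Little–O'Shea Ch. 1 §5 Ex. 15(a) `associated_div_gcd_derivative_radical`, stated there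
for Mathlib's normalised `gcd`, transported along N110's `associated_euclidGcd_gcd`). -/
theorem associated_div_euclidGcd_derivative_radical [DecidableEq K] [CharZero K] {m : K[X]} (hm : m ≠ 0) :
    Associated (m / EuclideanDomain.gcd m (derivative m)) (UniqueFactorizationMonoid.radical m) := by
  have h1 := (Literature.RingTheory.MvPolynomial.PrincipalIdealRadicalFormula.associated_div_gcd_derivative_radical m hm).1
  -- `m / g₁ = u · (m / g₂)` for the associated exact divisors `g₁ · u = g₂` of `m`
  have hA := associated_euclidGcd_gcd K m (derivative m)
  have hg₁ : EuclideanDomain.gcd m (derivative m) ≠ 0 := fun h0 => hm (EuclideanDomain.gcd_eq_zero_iff.mp h0).1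
  have hg₂ := hA.ne_zero_iff.mp hg₁
  obtain ⟨u, hu⟩ := hA
  have e1 := gcd_mul_div_gcd_derivative K m
  have e2 := EuclideanDomain.mul_div_cancel' hg₂ (gcd_dvd_left m (derivative m))
  have hq : m / EuclideanDomain.gcd m (derivative m) = ↑u * (m / gcd m (derivative m)) :=
    mul_left_cancel₀ hg₁ (by rw [e1, ← mul_assoc, hu, e2])
  rw [hq]
  exact (associated_unit_mul_left _ _ u.isUnit).trans h1

/-- Characteristic `0`: `deg (m / gcd(m, m′)) = deg rad m` (`m ≠ 0`). -/
theorem natDegree_div_gcd_derivative_eq_natDegree_radical [DecidableEq K] [CharZero K] {m : K[X]} (hm : m ≠ 0) :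
    (m / EuclideanDomain.gcd m (derivative m)).natDegree = (UniqueFactorizationMonoid.radical m).natDegree :=
  Polynomial.natDegree_eq_of_degree_eq (Polynomial.degree_eq_degree_of_associated (associated_div_euclidGcd_derivative_radical K hm))

end Summit.Ventures.HSemireg.Wedge.HankelOuter
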